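/-
# NextRungP4g21 — literal pre-payment for the LRA adversary; the sectioned value is degenerate (planner p4 g21)

Crux `stmt-PneNP-18538` = `Theses.KrwChromaticSteering.StrongComposition` (C1, verbatim, never restated here as a target).
Defs-only sketch + three kernel-checked lemmas; NOT a registered skeleton (director 10:14:05Z: no third line).
Companion memo: `Cruxes/StrongComposition/LensBarrierP4g21.md`.

Contents
* §0 vocabulary — verbatim restatements (`P4g20X` / `P4g19` / `KrwLrad`), so that this file imports only the route file
  and the Literature game (crux workfiles and unbuilt Theorems are not importable in `lean check`).
* §1 `SecTree`, `SecTree.Good`, `SectionedValueDegenerate` — g20 §3.6(a)'s sectioned row value W, typed, and the claim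
  that kills it: W(S,T) ≤ ⌈log₂ n⌉ + 2 for EVERY disjoint rectangle (memo §1; ≈ 100-line proof for a bench seat).
* §2 literal pre-payment objects: `affHull`, `litDim`, `proj`, `labParity` and the two bookkeeping facts the potential
  Φ♯ = (ℓ − π_A − π_B) + min(min K, k − 1) needs (`LitDimDeclare`, `LitDimParitySplit`; F₂ linear algebra, support-sized).
* §3 PROVED: `hard_split_alice` / `hard_split_bob` (partition form of the KW adversary step), the **forced-half lemma**
  `forcedHalf_alice` / `forcedHalf_bob` (against a constant opposite label, the same-coordinate kill costs ≤ 1 ALWAYS — the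
  other half is solved by a leaf) and the **multi-forced-half lemma** `multiForcedHalf_alice` / `multiForcedHalf_bob`: ANY NUMBER
  of simultaneous same-coordinate kills against constant opposite labels cost ≤ 1 + ⌈log₂ #kills⌉ IN TOTAL (Alice says whether
  she agrees with the constants and otherwise names a disagreeing coordinate, `KWTree.aliceChoose`) — the tool that prices a
  whole closure (memo §4) at one label unit up to the logarithmic slack C1 allows.
* §4 the rung statements `StrongCompositionLRA` (verbatim P4g18) with `lra_of_strongComposition : C1 → it`, and the
  quantitative form `LRAQuantitative` the declared-row adversary would prove (shape of `P4g20X.LRBQuantitative`, class LRA,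
  constant existential — typing checklist 4c(iv)).
-/
import Mathlib
import Summits.PneNP.PneNP.Theses.KrwChromaticSteering
import Literature.Computability.Complexity.KRWComposition

set_option linter.dupNamespace false

namespace Summit.PneNP.PneNP.Cruxes.StrongComposition.P4g21X

open Literature.Computability.Complexity

universe u

/-! ## §0 Vocabulary (verbatim) -/

section Vocabulary

variable {ι : Type u} {m n : ℕ}

/-- [verbatim `KrwLrad.SolvesRect`] the tree `Q` solves the KW game on the rectangle `A × B`. -/
def SolvesRect (Q : KWTree ι) (A B : Set (ι → Bool)) : Prop :=
  ∀ a ∈ A, ∀ b ∈ B, a (Q.run a b) ≠ b (Q.run a b)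

/-- [verbatim `KrwLrad.Hard`] every tree solving `A × B` has depth `≥ ℓ`. -/
def Hard (A B : Set (ι → Bool)) (ℓ : ℕ) : Prop :=
  ∀ Q : KWTree ι, SolvesRect Q A B → ℓ ≤ Q.depth

/-- [verbatim `KrwLrad.parityOn`] parity of the entries of `X` on a support `S ⊆ [m] × [n]`. -/
def parityOn (S : Finset (Fin m × Fin n)) (X : Fin m × Fin n → Bool) : Bool :=
  Nat.bodd (S.filter fun p => X p = true).card

/-- [verbatim `KrwLrad.IsLabelTest`] a function of the own label vector only. -/
def IsLabelTest (g : (Fin n → Bool) → Bool) (s : (Fin m × Fin n → Bool) → Bool) : Prop :=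
  ∃ φ : (Fin m → Bool) → Bool, ∀ X, s X = φ (rowLabels g X)

/-- [verbatim `P4g18.IsAffineTest`] `X ↦ c ⊕ ⨁_{p ∈ S} X p`. -/
def IsAffineTest (s : (Fin m × Fin n → Bool) → Bool) : Prop :=
  ∃ (S : Finset (Fin m × Fin n)) (c : Bool), ∀ X, s X = Bool.xor c (parityOn S X)

/-- [verbatim `P4g18.IsRowTest`] a function of one own row `X_i`, `i` fixed at the node. -/
def IsRowTest (s : (Fin m × Fin n → Bool) → Bool) : Prop :=
  ∃ (i : Fin m) (ψ : (Fin n → Bool) → Bool), ∀ X, s X = ψ (row X i)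

/-- [verbatim `P4g18.LabelRowAffine`] class LRA: every node test is a label test, a single-row test or an affine test. -/
def LabelRowAffine (g : (Fin n → Bool) → Bool) : KWTree (Fin m × Fin n) → Prop
  | .leaf _ => True
  | .alice s P Q => (IsLabelTest g s ∨ IsRowTest s ∨ IsAffineTest s) ∧ LabelRowAffine g P ∧ LabelRowAffine g Q
  | .bob s P Q => (IsLabelTest g s ∨ IsRowTest s ∨ IsAffineTest s) ∧ LabelRowAffine g P ∧ LabelRowAffine g Q

/-- [verbatim `KrwLrad.rowParity`] parity of a row vector on `S ⊆ [n]`. -/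
def rowParity (S : Finset (Fin n)) (x : Fin n → Bool) : Bool := Nat.bodd (S.filter fun j => x j = true).card

/-- [verbatim `KrwLrad.AffGeneric`] `r`-affine-genericity of `g` by equations. -/
def AffGeneric (g : (Fin n → Bool) → Bool) (r : ℕ) : Prop :=
  ∀ E : List (Finset (Fin n) × Bool), E.length + r + 1 ≤ n →
    (∃ x, ∀ e ∈ E, rowParity e.1 x = e.2) → ∀ β : Bool, ∃ x, (∀ e ∈ E, rowParity e.1 x = e.2) ∧ g x = β

/-- [verbatim `P4g20X.SubspaceHard`] the guarded subspace-hardness of `g` with budget `q` (S0⁺, g20 repair). -/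
def SubspaceHard (g : (Fin n → Bool) → Bool) (q : ℕ) : Prop :=
  ∀ F : List (Finset (Fin n) × Bool), F.length ≤ q → (∃ x, ∀ e ∈ F, rowParity e.1 x = e.2) →
    Hard {x | (∀ e ∈ F, rowParity e.1 x = e.2) ∧ g x = true}
         {x | (∀ e ∈ F, rowParity e.1 x = e.2) ∧ g x = false} (q - F.length)

end Vocabulary

/-! ## §1 The sectioned value W of g20 §3.6(a), typed — and why it is degenerate

`SecTree n` = protocols for one row's KW game with an extra move `sec u c`: BOTH players' sets are cut to the hyperplane
`{rowParity u · = c}` at unit cost and the complementary parts are DISCARDED (need not be solved).  `Good P S T` = `P` solves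
`S × T` in this sense; W(S,T) = least depth of a good tree.  g20 proposed «all reachable configurations are W-hard» as the row
credit that would dissolve the decoupling tax.  It cannot: `SectionedValueDegenerate` (memo §1) — plant a singleton with
one Alice partition, isolate it with one section, let Bob binary-search a coordinate where `y ≠ p`. -/

section Sectioned

variable {n : ℕ}

/-- Row protocols with two-sided sections. -/
inductive SecTree (n : ℕ) : Type
  | leaf : Fin n → SecTree n
  | alice : ((Fin n → Bool) → Bool) → SecTree n → SecTree n → SecTree n
  | bob : ((Fin n → Bool) → Bool) → SecTree n → SecTree n → SecTree n
  | sec : Finset (Fin n) → Bool → SecTree n → SecTree n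

/-- Depth: partitions and sections cost 1 each. -/
def SecTree.depth : SecTree n → ℕ
  | .leaf _ => 0
  | .alice _ P Q => max P.depth Q.depth + 1
  | .bob _ P Q => max P.depth Q.depth + 1
  | .sec _ _ P => P.depth + 1

/-- `P` is good for `S × T`: leaves are monochromatic differences; at a partition BOTH children must be good (the adversary
keeps either side); at a section only the kept two-sided slice must be good (`u ≠ ∅`). -/
def SecTree.Good : SecTree n → Set (Fin n → Bool) → Set (Fin n → Bool) → Prop
  | .leaf j, S, T => ∀ x ∈ S, ∀ y ∈ T, x j ≠ y j
  | .alice s P Q, S, T => P.Good {x | x ∈ S ∧ s x = false} T ∧ Q.Good {x | x ∈ S ∧ s x = true} T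
  | .bob s P Q, S, T => P.Good S {y | y ∈ T ∧ s y = false} ∧ Q.Good S {y | y ∈ T ∧ s y = true}
  | .sec u c P, S, T => u.Nonempty ∧ P.Good {x | x ∈ S ∧ rowParity u x = c} {y | y ∈ T ∧ rowParity u y = c}

/-- **W is degenerate (kills g20 §3.6(a); refuter/bench-checkable, ≈ 100 lines).**  For every `n ≥ 1` and every pair of
disjoint sets `S, T ⊆ {0,1}ⁿ` there is a good sectioned tree of depth `≤ ⌈log₂ n⌉ + 2`.  Proof (memo §1): if `S` is empty or
a singleton go to the last step; else pick a coordinate `j` on which `S` is not constant, `p ∈ S` with `p j = true`, `p' ∈ S`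
with `p' j = false`; Alice-partition `S` into `A₀ = {p} ∪ {x ∈ S | x j = false, x ≠ p'}` and `A₁ = {p'} ∪ {x ∈ S | x j = true,
x ≠ p}`; under `A₀` section to `{x j = true}` (Alice's slice is `{p}`), under `A₁` to `{x j = false}` (slice `{p'}`); finally,
against a singleton `{p}`, Bob announces by binary search a coordinate where `y ≠ p` (`⌈log₂ n⌉` partitions; it exists since
`p ∉ T`).  Hence `SectionedHard g (n − O(log n))` is false for large `n` and no section-closed game value can serve as row
credit; the n = 4 census value W = 2 of g20 is consistent with the bound. -/
def SectionedValueDegenerate : Prop :=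
  ∀ n : ℕ, 1 ≤ n → ∀ S T : Set (Fin n → Bool), (∀ x ∈ S, ∀ y ∈ T, x ≠ y) →
    ∃ P : SecTree n, P.Good S T ∧ P.depth ≤ Nat.clog 2 n + 2

end Sectioned

/-! ## §2 Literal pre-payment: the objects of the potential Φ♯

Declared_P := the rows player P has row-tested.  π_P := `litDim (proj Declared_P AE_P)` = affine F₂-dimension of the
projection of P's alive label set onto its declared coordinates = the number of independent literal parities a protocol can
still extract for free through P's shaped classes.  Φ♯ := (ℓ − π_A − π_B) + min (min_{declared, alive} K_i) (k − 1).
`LitDimDeclare`: declaring one more row raises π by ≤ 1 (the declaration bit pays for it).  `LitDimParitySplit`: restricting the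
label set to one value of a non-constant literal parity lowers π by ≥ 1 (offsets the `Hard.split` charge ℓ − 1 exactly; any
extra drop only RAISES Φ♯).  Both are plain F₂ linear algebra (support-sized); stated here, not proved. -/

section Literal

variable {ι : Type u}

/-- Coordinatewise `x ⊕ y ⊕ z` — the ternary operation whose closed sets are the affine F₂-subspaces (and `∅`). -/
def xor3 (x y z : ι → Bool) : ι → Bool := fun i => Bool.xor (Bool.xor (x i) (y i)) (z i)

/-- Closed under `xor3` = an affine subspace of `F₂^ι` or empty. -/
def AffClosed (P : Set (ι → Bool)) : Prop := ∀ x ∈ P, ∀ y ∈ P, ∀ z ∈ P, xor3 x y z ∈ P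

/-- The affine hull: the least `xor3`-closed superset. -/
def affHull (P : Set (ι → Bool)) : Set (ι → Bool) := ⋂₀ {Q | P ⊆ Q ∧ AffClosed Q}

theorem subset_affHull (P : Set (ι → Bool)) : P ⊆ affHull P :=
  fun _ hx => Set.mem_sInter.2 fun _ hQ => hQ.1 hx

theorem affClosed_affHull (P : Set (ι → Bool)) : AffClosed (affHull P) := by
  intro x hx y hy z hz
  refine Set.mem_sInter.2 fun Q hQ => hQ.2 x ?_ y ?_ z ?_
  · exact Set.mem_sInter.1 hx Q hQ
  · exact Set.mem_sInter.1 hy Q hQ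
  · exact Set.mem_sInter.1 hz Q hQ

theorem affHull_eq_self_of_affClosed {P : Set (ι → Bool)} (h : AffClosed P) : affHull P = P :=
  Set.Subset.antisymm (Set.sInter_subset_of_mem ⟨subset_rfl, h⟩) (subset_affHull P)

/-- Affine F₂-dimension, as `⌊log₂ |affHull P|⌋` (`= dim` for nonempty `P` over a finite index type; `0` for `P = ∅`). -/
noncomputable def litDim (P : Set (ι → Bool)) : ℕ := Nat.log 2 (Nat.card (affHull P))

variable {m : ℕ}

/-- Projection of a label vector onto the declared coordinates `D` (zero elsewhere; keeps the ambient type). -/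
def projZ (D : Finset (Fin m)) (a : Fin m → Bool) : Fin m → Bool := fun i => if i ∈ D then a i else false

/-- Projection of a label set onto the declared coordinates. -/
def proj (D : Finset (Fin m)) (A : Set (Fin m → Bool)) : Set (Fin m → Bool) := projZ D '' A

/-- A literal parity `⨁_{i ∈ U} a_i`. -/
def labParity (U : Finset (Fin m)) (a : Fin m → Bool) : Bool := Nat.bodd (U.filter fun i => a i = true).card

theorem labParity_projZ {D U : Finset (Fin m)} (hU : U ⊆ D) (a : Fin m → Bool) :
    labParity U (projZ D a) = labParity U a := by
  unfold labParity projZ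
  congr 2
  refine Finset.filter_congr fun i hi => ?_
  simp [hU hi]

/-- (π1) **support**: declaring one more row raises the extractable-literal dimension by at most one. -/
def LitDimDeclare : Prop :=
  ∀ (m : ℕ) (D : Finset (Fin m)) (i : Fin m) (A : Set (Fin m → Bool)),
    litDim (proj (insert i D) A) ≤ litDim (proj D A) + 1

/-- (π2) **support**: fixing a literal parity that is non-constant on the label set (support inside the declared rows) lowers
the extractable-literal dimension by at least one. -/
def LitDimParitySplit : Prop :=
  ∀ (m : ℕ) (D U : Finset (Fin m)) (A : Set (Fin m → Bool)) (γ : Bool), U ⊆ D →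
    (∃ a ∈ A, ∃ a' ∈ A, labParity U a ≠ labParity U a') →
    litDim (proj D {a | a ∈ A ∧ labParity U a = γ}) + 1 ≤ litDim (proj D A)

end Literal

/-! ## §3 The forced-half lemmas (PROVED)

Closure kills (memo §4) restrict Alice to `a_j = v` where `v` is the constant value of `b_j` on Bob's alive labels — a
FORCED value, so `Hard.split`'s «one of the two halves stays hard» seems not to protect it.  It does: the other half
`{a_j ≠ v} × B` is solved by the leaf `j`, so it is the forced half that inherits hardness `≥ ℓ − 1`.  Better: a whole SET
`L` of such kills costs `≤ 1 + ⌈log₂ |L|⌉` in total (`multiForcedHalf_*`), because Alice can say in one bit whether she agrees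
with all the constants and otherwise name a disagreeing coordinate, which is a valid answer.  So a closure releasing `s/2`
kills (memo §4.1) costs the label term ONE unit plus `log₂ s ≤ log₂ m` — inside C1's `c·(log₂(mn)+1)` — not `s/2`. -/

section ForcedHalf

variable {ι : Type u}

open Classical in
/-- KW adversary step, partition form (Alice): one side of any partition of `A` keeps hardness `ℓ − 1`. -/
theorem hard_split_alice {A B : Set (ι → Bool)} {ℓ : ℕ} (h : Hard A B ℓ) (s : (ι → Bool) → Prop) :
    Hard {a | a ∈ A ∧ ¬ s a} B (ℓ - 1) ∨ Hard {a | a ∈ A ∧ s a} B (ℓ - 1) := by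
  by_contra hc
  obtain ⟨h0, h1⟩ := not_or.1 hc
  simp only [Hard, not_forall, not_le] at h0 h1
  obtain ⟨Q0, hQ0, d0⟩ := h0
  obtain ⟨Q1, hQ1, d1⟩ := h1
  have hsol : SolvesRect (KWTree.alice (fun a => decide (s a)) Q0 Q1) A B := by
    intro a ha b hb
    by_cases hs : s a
    · simpa [KWTree.run, hs] using hQ1 a ⟨ha, hs⟩ b hb
    · simpa [KWTree.run, hs] using hQ0 a ⟨ha, hs⟩ b hb
  have hd := h _ hsol
  simp only [KWTree.depth] at hd
  have hmax : max Q0.depth Q1.depth < ℓ - 1 := max_lt d0 d1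
  generalize max Q0.depth Q1.depth = M at hd hmax
  omega

open Classical in
/-- KW adversary step, partition form (Bob). -/
theorem hard_split_bob {A B : Set (ι → Bool)} {ℓ : ℕ} (h : Hard A B ℓ) (s : (ι → Bool) → Prop) :
    Hard A {b | b ∈ B ∧ ¬ s b} (ℓ - 1) ∨ Hard A {b | b ∈ B ∧ s b} (ℓ - 1) := by
  by_contra hc
  obtain ⟨h0, h1⟩ := not_or.1 hc
  simp only [Hard, not_forall, not_le] at h0 h1
  obtain ⟨Q0, hQ0, d0⟩ := h0
  obtain ⟨Q1, hQ1, d1⟩ := h1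
  have hsol : SolvesRect (KWTree.bob (fun b => decide (s b)) Q0 Q1) A B := by
    intro a ha b hb
    by_cases hs : s b
    · simpa [KWTree.run, hs] using hQ1 a ha b ⟨hb, hs⟩
    · simpa [KWTree.run, hs] using hQ0 a ha b ⟨hb, hs⟩
  have hd := h _ hsol
  simp only [KWTree.depth] at hd
  have hmax : max Q0.depth Q1.depth < ℓ - 1 := max_lt d0 d1
  generalize max Q0.depth Q1.depth = M at hd hmax
  omega

/-- **Forced-half lemma (Alice).** If `b_j = v` on all of `B`, the forced restriction `a_j = v` keeps hardness `ℓ − 1`. -/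
theorem forcedHalf_alice {A B : Set (ι → Bool)} {ℓ : ℕ} (h : Hard A B ℓ) (j : ι) (v : Bool)
    (hB : ∀ b ∈ B, b j = v) : Hard {a | a ∈ A ∧ a j = v} B (ℓ - 1) := by
  rcases hard_split_alice h (fun a => a j = v) with h0 | h1
  · have hsol : SolvesRect (KWTree.leaf j) {a | a ∈ A ∧ ¬ a j = v} B := by
      intro a ha b hb
      simp only [KWTree.run_leaf, ne_eq, hB b hb]
      exact ha.2
    have h0' := h0 _ hsol
    simp only [KWTree.depth_leaf] at h0'
    intro Q _
    omega
  · exact h1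

/-- **Forced-half lemma (Bob).** -/
theorem forcedHalf_bob {A B : Set (ι → Bool)} {ℓ : ℕ} (h : Hard A B ℓ) (j : ι) (v : Bool)
    (hA : ∀ a ∈ A, a j = v) : Hard A {b | b ∈ B ∧ b j = v} (ℓ - 1) := by
  rcases hard_split_bob h (fun b => b j = v) with h0 | h1
  · have hsol : SolvesRect (KWTree.leaf j) A {b | b ∈ B ∧ ¬ b j = v} := by
      intro a ha b hb
      simp only [KWTree.run_leaf, ne_eq, hA a ha]
      exact fun h => hb.2 h.symm
    have h0' := h0 _ hsol
    simp only [KWTree.depth_leaf] at h0'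
    intro Q _
    omega
  · exact h1

open Classical in
/-- **Multi-forced-half lemma (Alice).** If `b_j = v_j` on `B` for every `j ∈ L`, restricting `A` to
`{a | ∀ j ∈ L, a_j = v_j}` SIMULTANEOUSLY costs at most `1 + ⌈log₂ |L|⌉` of hardness: Alice says whether
`a` agrees with `v` on `L` and, if not, names a disagreeing `j ∈ L`, which is a valid answer. -/
theorem multiForcedHalf_alice {A B : Set (ι → Bool)} {ℓ : ℕ} (h : Hard A B ℓ) (L : List ι) (v : ι → Bool)
    (hB : ∀ b ∈ B, ∀ j ∈ L, b j = v j) :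
    Hard {a | a ∈ A ∧ ∀ j ∈ L, a j = v j} B (ℓ - 1 - Nat.clog 2 L.length) := by
  set k := Nat.clog 2 L.length with hk
  by_cases hsmall : ℓ ≤ k + 1
  · intro Q _
    omega
  rw [not_le] at hsmall
  -- L is nonempty (else k = 0 and... actually we only need a default element when naming)
  by_contra hc
  simp only [Hard, not_forall, not_le] at hc
  obtain ⟨Q', hQ', hd'⟩ := hc
  -- the naming tree
  have hLne : L ≠ [] := by
    intro hL
    subst hL
    -- then A' = A ∩ {True}, and Q' solves A × B with depth < ℓ - 1: contradiction with h
    have : SolvesRect Q' A B := fun a ha b hb => hQ' a ⟨ha, by simp⟩ b hb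
    have := h Q' this
    omega
  obtain ⟨j₀, hj₀⟩ : ∃ j, j ∈ L := List.exists_mem_of_ne_nil L hLne
  let pick : (ι → Bool) → ℕ := fun a =>
    if hex : ∃ i : Fin L.length, a (L.get i) ≠ v (L.get i) then (Classical.choose hex).val else 0
  let T : ℕ → KWTree ι := fun i => KWTree.leaf (if hi : i < L.length then L.get ⟨i, hi⟩ else j₀)
  let namer : KWTree ι := KWTree.aliceChoose k pick T
  let Q : KWTree ι := KWTree.alice (fun a => decide (∀ j ∈ L, a j = v j)) namer Q'
  have hnd : namer.depth ≤ k + 0 :=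
    KWTree.depth_aliceChoose_le k pick T 0 (fun i _ => by simp [T])
  have hsol : SolvesRect Q A B := by
    intro a ha b hb
    by_cases hagree : ∀ j ∈ L, a j = v j
    · have hdec : decide (∀ j ∈ L, a j = v j) = true := decide_eq_true hagree
      have hrun : Q.run a b = Q'.run a b := by
        simp only [Q, KWTree.run_alice, hdec]
        simp
      rw [hrun]
      exact hQ' a ⟨ha, hagree⟩ b hb
    · have hdec : decide (∀ j ∈ L, a j = v j) = false := decide_eq_false hagree
      have hrun : Q.run a b = namer.run a b := by
        simp only [Q, KWTree.run_alice, hdec]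
        simp
      rw [hrun]
      have hex : ∃ i : Fin L.length, a (L.get i) ≠ v (L.get i) := by
        obtain ⟨j, hjL, hj⟩ : ∃ j ∈ L, a j ≠ v j := by simpa using hagree
        obtain ⟨i, hi⟩ := List.mem_iff_get.1 hjL
        exact ⟨i, by rw [hi]; exact hj⟩
      have hpick : pick a = (Classical.choose hex).val := by
        simp only [pick]
        rw [dif_pos hex]
      have hlt : pick a < 2 ^ k := by
        rw [hpick]
        exact lt_of_lt_of_le (Classical.choose hex).isLt (hk ▸ Nat.le_pow_clog one_lt_two _)
      have hrun2 : namer.run a b = (T (pick a)).run a b := KWTree.run_aliceChoose k pick T a b hlt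
      rw [hrun2]
      have hspec := Classical.choose_spec hex
      have hlt' : pick a < L.length := hpick ▸ (Classical.choose hex).isLt
      have hidx : (T (pick a)).run a b = L.get ⟨pick a, hlt'⟩ := by
        simp only [T, KWTree.run_leaf, dif_pos hlt']
      have hfin : (⟨pick a, hlt'⟩ : Fin L.length) = Classical.choose hex := Fin.ext hpick
      rw [hidx, hfin]
      have hjmem : L.get (Classical.choose hex) ∈ L := List.get_mem L _
      rw [ne_eq, hB b hb _ hjmem]
      exact hspec
  have hQd := h Q hsol
  have : Q.depth = max namer.depth Q'.depth + 1 := by simp [Q, KWTree.depth]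
  rw [this] at hQd
  generalize namer.depth = N at hQd hnd
  generalize Q'.depth = D at hQd hd'
  omega

open Classical in
/-- **Multi-forced-half lemma (Bob).** Symmetric statement: `a_j = v_j` on `A` for every `j ∈ L`; restricting `B`
to `{b | ∀ j ∈ L, b_j = v_j}` costs at most `1 + ⌈log₂ |L|⌉`. -/
theorem multiForcedHalf_bob {A B : Set (ι → Bool)} {ℓ : ℕ} (h : Hard A B ℓ) (L : List ι) (v : ι → Bool)
    (hA : ∀ a ∈ A, ∀ j ∈ L, a j = v j) :
    Hard A {b | b ∈ B ∧ ∀ j ∈ L, b j = v j} (ℓ - 1 - Nat.clog 2 L.length) := by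
  set k := Nat.clog 2 L.length with hk
  by_cases hsmall : ℓ ≤ k + 1
  · intro Q _
    omega
  rw [not_le] at hsmall
  -- L is nonempty (else k = 0 and... actually we only need a default element when naming)
  by_contra hc
  simp only [Hard, not_forall, not_le] at hc
  obtain ⟨Q', hQ', hd'⟩ := hc
  -- the naming tree
  have hLne : L ≠ [] := by
    intro hL
    subst hL
    -- then A' = A ∩ {True}, and Q' solves A × B with depth < ℓ - 1: contradiction with h
    have : SolvesRect Q' A B := fun a ha b hb => hQ' a ha b ⟨hb, by simp⟩
    have := h Q' this
    omega
  obtain ⟨j₀, hj₀⟩ : ∃ j, j ∈ L := List.exists_mem_of_ne_nil L hLne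
  let pick : (ι → Bool) → ℕ := fun b =>
    if hex : ∃ i : Fin L.length, b (L.get i) ≠ v (L.get i) then (Classical.choose hex).val else 0
  let T : ℕ → KWTree ι := fun i => KWTree.leaf (if hi : i < L.length then L.get ⟨i, hi⟩ else j₀)
  let namer : KWTree ι := KWTree.bobChoose k pick T
  let Q : KWTree ι := KWTree.bob (fun b => decide (∀ j ∈ L, b j = v j)) namer Q'
  have hnd : namer.depth ≤ k + 0 :=
    KWTree.depth_bobChoose_le k pick T 0 (fun i _ => by simp [T])
  have hsol : SolvesRect Q A B := by
    intro a ha b hb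
    by_cases hagree : ∀ j ∈ L, b j = v j
    · have hdec : decide (∀ j ∈ L, b j = v j) = true := decide_eq_true hagree
      have hrun : Q.run a b = Q'.run a b := by
        simp only [Q, KWTree.run_bob, hdec]
        simp
      rw [hrun]
      exact hQ' a ha b ⟨hb, hagree⟩
    · have hdec : decide (∀ j ∈ L, b j = v j) = false := decide_eq_false hagree
      have hrun : Q.run a b = namer.run a b := by
        simp only [Q, KWTree.run_bob, hdec]
        simp
      rw [hrun]
      have hex : ∃ i : Fin L.length, b (L.get i) ≠ v (L.get i) := by
        obtain ⟨j, hjL, hj⟩ : ∃ j ∈ L, b j ≠ v j := by simpa using hagree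
        obtain ⟨i, hi⟩ := List.mem_iff_get.1 hjL
        exact ⟨i, by rw [hi]; exact hj⟩
      have hpick : pick b = (Classical.choose hex).val := by
        simp only [pick]
        rw [dif_pos hex]
      have hlt : pick b < 2 ^ k := by
        rw [hpick]
        exact lt_of_lt_of_le (Classical.choose hex).isLt (hk ▸ Nat.le_pow_clog one_lt_two _)
      have hrun2 : namer.run a b = (T (pick b)).run a b := KWTree.run_bobChoose k pick T a b hlt
      rw [hrun2]
      have hspec := Classical.choose_spec hex
      have hlt' : pick b < L.length := hpick ▸ (Classical.choose hex).isLt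
      have hidx : (T (pick b)).run a b = L.get ⟨pick b, hlt'⟩ := by
        simp only [T, KWTree.run_leaf, dif_pos hlt']
      have hfin : (⟨pick b, hlt'⟩ : Fin L.length) = Classical.choose hex := Fin.ext hpick
      rw [hidx, hfin]
      have hjmem : L.get (Classical.choose hex) ∈ L := List.get_mem L _
      rw [ne_eq, hA a ha _ hjmem]
      exact fun h' => hspec h'.symm
  have hQd := h Q hsol
  have : Q.depth = max namer.depth Q'.depth + 1 := by simp [Q, KWTree.depth]
  rw [this] at hQd
  generalize namer.depth = N at hQd hnd
  generalize Q'.depth = D at hQd hd'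
  omega

end ForcedHalf

/-! ## §4 The rung: C1|LRA and its quantitative form -/

section Rung

variable {m n : ℕ}

/-- [verbatim `P4g18.StrongCompositionLRA`] **Rung C1|LRA** (OPEN): strong composition with C1's own loss for every protocol
whose node tests are label tests, single-row tests or affine tests (untyped, any order, both players). -/
def StrongCompositionLRA : Prop :=
  ∃ c : ℕ, ∀ m n : ℕ, 1 ≤ n → ∀ f : (Fin m → Bool) → Bool, (∃ a b, f a ≠ f b) →
    ∃ g : (Fin n → Bool) → Bool, ∀ P : KWTree (Fin m × Fin n), LabelRowAffine g P → P.SolvesStrong f g →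
      ∃ Q : KWTree (Fin m), Q.Solves f ∧ Q.depth + n ≤ P.depth + c * (Nat.log 2 (m * n) + 1)

/-- Sanity: the crux implies the rung (LRA is a syntactic subclass of all protocols). -/
theorem lra_of_strongComposition (h : Theses.KrwChromaticSteering.StrongComposition) : StrongCompositionLRA := by
  obtain ⟨c, hc⟩ := h
  refine ⟨c, fun m n hn f hf => ?_⟩
  obtain ⟨g, hg⟩ := hc m n hn f hf
  exact ⟨g, fun P _ hP => hg P hP⟩

/-- **`LRAQuantitative` (the statement the declared-row adversary of memo §3 would prove; NOT registered).**  Shape of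
`P4g20X.LRBQuantitative` with the class widened LRB ↦ LRA: every LRA protocol for the strong game of a non-constant `f` (label
rectangle of hardness `ℓ`) against an `r`-affinely-generic, `q`-subspace-hard `g` with `q + r + 1 ≤ n` has depth
`≥ ℓ + (q − 1) − C·(log₂(mn) + 1)` — the additive loss is LOGARITHMIC and existential, not absolute: the multi-forced-half
lemma (§3) prices a closure at `1 + ⌈log₂ #kills⌉`, and an absolute `C` would be a hand-picked constant tighter than the
assembly needs (typing checklist 4c(iv); `StrongCompositionLRA` absorbs `C·(log₂(mn)+1)`).  Intended proof: the potential
Φ♯ = (L − π_A − π_B) + min(min K, k − 1) of §2 over the declared-row state (memo §3, §4.7), L = max(true label hardness,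
⌈log₂ m⌉ + 1) with lazy dormancy — typed as the target of the next rung, not claimed. -/
def LRAQuantitative : Prop :=
  ∃ C : ℕ, ∀ (m n q r ℓ : ℕ) (f : (Fin m → Bool) → Bool) (g : (Fin n → Bool) → Bool),
    (∃ a b, f a = true ∧ f b = false) →
    AffGeneric g r → q + r + 1 ≤ n → SubspaceHard g q → 1 ≤ q →
    Hard (f ⁻¹' {true}) (f ⁻¹' {false}) ℓ →
    ∀ P : KWTree (Fin m × Fin n), LabelRowAffine g P → P.SolvesStrong f g →
      ℓ + (q - 1) ≤ P.depth + C * (Nat.log 2 (m * n) + 1)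

end Rung

end Summit.PneNP.PneNP.Cruxes.StrongComposition.P4g21X
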